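import Literature.Analysis.FluidPDE.SereginSverakBlowupDecay
import Literature.Analysis.FluidPDE.SereginSverakAxisWeightedCubic
import Literature.Analysis.FluidPDE.SereginSverakGradientEnergy
import Literature.Analysis.FluidPDE.SereginSverakPressureDecay
import Literature.Analysis.FluidPDE.HessianLaplacianLpProofs
import HarnessLib

/-!
# Seregin–Šverák 2009, Lemma 3.6, discharged: `ScaledEnergyBound36_holds`

G. Seregin, V. Šverák, *On Type I singularities of the local axi-symmetric solutions of the
Navier–Stokes equations*, Comm. PDE 34 (2009) 171–201 = arXiv:0804.1803 (labels and pages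
refer to the arXiv version). Lemma 3.6 (label asl5, arXiv p. 10):

> Under assumptions of Theorem 3.2, estimate (as4)
> [`A(z_b,r;v) + E(z_b,r;v) + C(z_b,r;v) + D(z_b,r;q) ≤ C₁ < +∞` for all `z_b = (b e₃, 0)`,
> `|b| ≤ 1/4`, `0 < r < 1/4`] is valid as well with constant `C₁` depending only on the constant
> `C` in (r4), `‖v‖_{L₃(Q)}`, and `‖q‖_{L_{3/2}(Q)}`.
> Lemma 3.6 is proved in the same way as Lemma 3.5 and even easier because main inequality
> (as11) can be established with the help of the case `s = s₁`, `l = l₁` only.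

It is vendored, uniformity included, as the named fact `SereginSverak2009.ScaledEnergyBound36`
(`SereginSverakBlowupDecay.lean`). This file PROVES it
(`SereginSverak2009.ScaledEnergyBound36_holds`), following the printed proof of Lemma 3.5
(arXiv pp. 9–10) with the four analytic inputs supplied by the tree under the hypotheses of
Thm. 3.2 (standing assumptions of §3 with axial symmetry, (r2), (r4) `|x'| |v| ≤ C` a.e. on `Q`):

* the weak spatial gradient `∇v ∈ L²_loc(Q)` of Remark 3.4 (through which `E` is computed):
  `exists_hasWeakSpatialGradientOn_energy_lt_top` (`SereginSverakGradientEnergy.lean`, energy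
  method under (r2));
* (as11), the absorption estimate for the cubic term "with the help of the case `s = s₁`,
  `l = l₁` only": the tree's weighted estimate `C(z_b, r; v) ≤ K₁ (C + 1)^{6/5}
  (A(z_b, 2r; v) + E(z_b, 2r; ∇v))^{9/10}` (`exists_cubicC_le_of_axisDecay`,
  `SereginSverakAxisWeightedCubic.lean`: weighted Hölder + Sobolev on balls, whence the doubled
  radius) and Young's inequality give `C(z_b, r) ≤ ε (E + A)(z_b, 2r) + f₁(ε, C)`
  (`cubicC_le_eps36`), `f₁` depending on `ε` and `C` ONLY;
* (as12), the local energy estimate `E(z_b, r/2) + A(z_b, r/2) ≤ c (C^{2/3} + C + D)(z_b, r)`,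
  `|b| ≤ 1/4`, `0 < r ≤ 1/2`: Remark 3.4 (`SuitableOfBounded_holds`, suitability under (r2)) and
  `dissipationE_add_energyA_le_of_suitable` (`SereginSverakLocalEnergy.lean`) —
  `localEnergy36`, with a universal constant;
* (as13), the pressure decay `D(z_b, ϱ) ≤ c [(ϱ/r) D(z_b, r) + (r/ϱ)² C(z_b, r)]`:
  `exists_setLIntegral_pressure_rpow_parCyl_le` (`SereginSverakPressureDecay.lean`) fed with
  Stein's Proposition 3 (`stein1970_hessian_Lp_bound_holds_fin3`) — `pressureDecay36`, universal
  constant; axial symmetry, (r2), (r4) are not used there.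

The iteration ("The rest of the proof is routine", p. 10) is the accepted abstract scheme of
`SereginSverakIteration.lean` (`decay_step`, `iterate_halving`) with one modification forced by
the doubled radius in (as11): the step `r ↦ ϑ r` is `decay_step` run from the radius `r/2` with
ratio `2ϑ`, the pressure term brought back to radius `r` by the monotonicity
`D(z_b, r/2) ≤ 4 D(z_b, r)`, and the cubic term at `r/2` absorbed by (as11) into
`ε (E + A)(z_b, r)` (`decay_step_half36`): `ℰ_b(ϑ r) ≤ ½ ℰ_b(r) + f₃`, `ℰ_b = E + A + D`, for
`(2K² + K)(8ϑ) ≤ ½`, `(6K + K²)(4ϑ)⁻² ε ≤ ½`. UNIFORMITY: `K` dominates the universal constants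
of (as12)–(as13); `ϑ`, `ε` depend on `K` only; `f₁ = f₁(ε, C)`; on the top scales
`ϑ/4 ≤ r < 1/4` the quantity `ℰ_b(r)` is bounded through (as12) at radius `2r < 1/2` and the
inclusions `Q(z_b, 2r) ⊆ Q` by `K`, `ϑ` and the two numbers `N₁ ≥ ∫_Q |v|³`, `N₂ ≥ ∫_Q |q|^{3/2}`
(so the bound (as6) of Lemma 3.3/Remark 3.4 is only needed qualitatively, for the existence of
`∇v`); `iterate_halving` then bounds `ℰ_b` on `(0, 1/4)` and (as11) (for `r < 1/8`) or the
inclusion `Q(z_b, r) ⊆ Q` (for `r ≥ 1/8`) bounds `C(z_b, r)`. The resulting `C₁` depends on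
`(C, N₁, N₂)` alone, as printed.

## References

* G. Seregin, V. Šverák, Comm. PDE 34 (2009) 171–201, arXiv:0804.1803: §3 p. 9 (Thm. 3.2, (r2),
  (r4), Remark 3.4, functionals `A, E, C, D`), Lemma 3.5 and its proof (as4)–(as13) (pp. 9–10),
  Lemma 3.6 (asl5, p. 10). [`SereginSverak2009`]
* E. M. Stein, *Singular integrals and differentiability properties of functions* (1970),
  Ch. III §1.3 Prop. 3 (the Calderón–Zygmund input of (as13)). [`Stein1971`]
-/

noncomputable section

open MeasureTheory Set Function Filter Topology TopologicalSpace Module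
open scoped NNReal ENNReal

namespace Literature.Analysis.FluidPDE

namespace SereginSverak2009

/-! ### (as13) at the axis centres, without the Type I hypothesis -/

/-- **Seregin–Šverák 2009, (as13) under the standing assumptions alone.** There is a universal
`c` such that for every pair `(u, p)` satisfying the standing assumptions of §3 (axial symmetry
is carried by `IsAxisymmetricLocalSolution` but not used), all `z_b = (b e₃, 0)`, `|b| ≤ 1/4`,
`0 < r < 1/4`, `0 < ϱ ≤ r`:
`D(z_b, ϱ; p) ≤ c [(ϱ/r) D(z_b, r; p) + (r/ϱ)² C(z_b, r; u)]`. This is the accepted reduction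
`PressureDecay.of_hessian_three_halves` (whose proof does not use the Type I bound) run again
without that hypothesis: `exists_setLIntegral_pressure_rpow_parCyl_le` on `Q(z_b, r) ⊆ Q` for
`ϱ ≤ r/4`, the monotonicity `D(ϱ) ≤ (r/ϱ)² D(r) ≤ 64 (ϱ/r) D(r)` for `r/4 < ϱ ≤ r`, with the
exponent-`3/2` Calderón–Zygmund constant from Stein's Proposition 3
(`stein1970_hessian_Lp_bound_holds_fin3`).
[cite: SereginSverak2009, proof of Lemma 3.5, (as13), as used for Lemma 3.6 (arXiv p. 10)] -/
theorem pressureDecay36 :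
    ∃ c : ℝ≥0, ∀ (u : ℝ → EuclideanSpace ℝ (Fin 3) → EuclideanSpace ℝ (Fin 3))
      (p : ℝ → EuclideanSpace ℝ (Fin 3) → ℝ), IsAxisymmetricLocalSolution u p →
      ∀ b : ℝ, |b| ≤ 1 / 4 → ∀ r ∈ Ioo (0 : ℝ) (1 / 4), ∀ ϱ ∈ Ioc (0 : ℝ) r,
        pressureD ((0 : ℝ), b • eZ) ϱ p ≤
          c * (ENNReal.ofReal (ϱ / r) * pressureD ((0 : ℝ), b • eZ) r p +
            ENNReal.ofReal ((r / ϱ) ^ 2) * cubicC ((0 : ℝ), b • eZ) r u) := by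
  -- the Calderón–Zygmund constant at exponent `3/2`, uniform in the scale (Stein, Prop. 3)
  have h132 : (1 : ℝ≥0∞) < 3 / 2 := by
    rw [ENNReal.lt_div_iff_mul_lt (Or.inl (by norm_num)) (Or.inl (by norm_num)), one_mul]
    exact_mod_cast (by norm_num : (2 : ℕ) < 3)
  have h32top : (3 / 2 : ℝ≥0∞) < ⊤ := ENNReal.div_lt_top (by norm_num) (by norm_num)
  obtain ⟨C, hC⟩ :=
    stein1970_hessian_Lp_bound_holds_fin3.hessian_newtonNearPotential_half h132 h32top
  obtain ⟨K, hKtop, hK⟩ := exists_setLIntegral_pressure_rpow_parCyl_le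
  -- the constant of (as13)
  set cE : ℝ≥0∞ := max (K * max 1 ((C : ℝ≥0∞) ^ (3 / 2 : ℝ))) 64 with hcE
  have hCtop : (C : ℝ≥0∞) ^ (3 / 2 : ℝ) ≠ ⊤ :=
    ENNReal.rpow_ne_top_of_nonneg (by norm_num) ENNReal.coe_ne_top
  have hcEtop : cE ≠ ⊤ :=
    (max_lt (lt_top_iff_ne_top.2 (ENNReal.mul_ne_top hKtop
      (max_lt ENNReal.one_lt_top (lt_top_iff_ne_top.2 hCtop)).ne))
      (by simp : (64 : ℝ≥0∞) < ⊤)).ne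
  refine ⟨cE.toNNReal, fun u p hsol b hb r hr ϱ hϱ => ?_⟩
  rw [ENNReal.coe_toNNReal hcEtop]
  have hr0 : 0 < r := hr.1
  have hϱ0 : 0 < ϱ := hϱ.1
  -- `Q(z_b, r) ⊆ Q`: restriction of the distributional solution and of the integrability classes
  have hsub : parCyl ((0 : ℝ), b • eZ) r ⊆ parCyl 0 1 :=
    parCyl_axis_subset hr0.le (by linarith [hr.2])
  have hle : parCylOpens ((0 : ℝ), b • eZ) r ≤ parCylOpens 0 1 := fun w hw => hsub hw
  have hsol' : IsDistributionalNSSolutionOn (parCylOpens ((0 : ℝ), b • eZ) r) 1 0 u p :=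
    hsol.distributional.of_le hle
  have hu3 : ∫⁻ w in parCyl ((0 : ℝ), b • eZ) r, ‖u w.1 w.2‖ₑ ^ (3 : ℕ) < ⊤ :=
    (lintegral_mono_set hsub).trans_lt hsol.velocity_L3
  have hp32 : ∫⁻ w in parCyl ((0 : ℝ), b • eZ) r, ‖p w.1 w.2‖ₑ ^ (3 / 2 : ℝ) < ⊤ :=
    (lintegral_mono_set hsub).trans_lt hsol.pressure_L32
  rcases le_or_gt ϱ (r / 4) with hϱr | hϱr
  · -- the main case `ϱ ≤ r/4`
    have hmain := hK C hC u p 1 0 (b • eZ) r ϱ hr0 hϱ0 hϱr hsol' hu3 hp32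
    rw [setLIntegral_eq_sq_mul_pressureD ((0 : ℝ), b • eZ) hr0,
      setLIntegral_eq_sq_mul_cubicC ((0 : ℝ), b • eZ) hr0] at hmain
    calc pressureD ((0 : ℝ), b • eZ) ϱ p
        = (ENNReal.ofReal ϱ ^ 2)⁻¹ *
            ∫⁻ w in parCyl ((0 : ℝ), b • eZ) ϱ, ‖p w.1 w.2‖ₑ ^ (3 / 2 : ℝ) := rfl
      _ ≤ (ENNReal.ofReal ϱ ^ 2)⁻¹ * (K * (ENNReal.ofReal ((ϱ / r) ^ 3) *
            (ENNReal.ofReal r ^ 2 * pressureD ((0 : ℝ), b • eZ) r p) +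
          (C : ℝ≥0∞) ^ (3 / 2 : ℝ) *
            (ENNReal.ofReal r ^ 2 * cubicC ((0 : ℝ), b • eZ) r u))) := by gcongr
      _ = K * ((ENNReal.ofReal ϱ ^ 2)⁻¹ * ENNReal.ofReal ((ϱ / r) ^ 3) * ENNReal.ofReal r ^ 2 *
            pressureD ((0 : ℝ), b • eZ) r p) +
          K * (C : ℝ≥0∞) ^ (3 / 2 : ℝ) * ((ENNReal.ofReal ϱ ^ 2)⁻¹ * ENNReal.ofReal r ^ 2 *
            cubicC ((0 : ℝ), b • eZ) r u) := by ring
      _ = K * (ENNReal.ofReal (ϱ / r) * pressureD ((0 : ℝ), b • eZ) r p) +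
          K * (C : ℝ≥0∞) ^ (3 / 2 : ℝ) *
            (ENNReal.ofReal ((r / ϱ) ^ 2) * cubicC ((0 : ℝ), b • eZ) r u) := by
          rw [inv_sq_mul_ofReal_cube_mul_sq hr0 hϱ0, inv_sq_mul_sq hr0 hϱ0]
      _ ≤ cE * (ENNReal.ofReal (ϱ / r) * pressureD ((0 : ℝ), b • eZ) r p) +
          cE * (ENNReal.ofReal ((r / ϱ) ^ 2) * cubicC ((0 : ℝ), b • eZ) r u) := by
          gcongr
          · calc K = K * 1 := (mul_one K).symm
              _ ≤ K * max 1 ((C : ℝ≥0∞) ^ (3 / 2 : ℝ)) := by gcongr; exact le_max_left _ _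
              _ ≤ cE := le_max_left _ _
          · calc K * (C : ℝ≥0∞) ^ (3 / 2 : ℝ) ≤ K * max 1 ((C : ℝ≥0∞) ^ (3 / 2 : ℝ)) := by
                  gcongr; exact le_max_right _ _
              _ ≤ cE := le_max_left _ _
      _ = cE * (ENNReal.ofReal (ϱ / r) * pressureD ((0 : ℝ), b • eZ) r p +
          ENNReal.ofReal ((r / ϱ) ^ 2) * cubicC ((0 : ℝ), b • eZ) r u) := by ring
  · -- the trivial case `r/4 < ϱ ≤ r`: `D(ϱ) ≤ (r/ϱ)² D(r) ≤ 64 (ϱ/r) D(r)`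
    have hratio : ENNReal.ofReal ((r / ϱ) ^ 2) ≤ 64 * ENNReal.ofReal (ϱ / r) := by
      rw [show (64 : ℝ≥0∞) = ENNReal.ofReal 64 by norm_num, ← ENNReal.ofReal_mul (by norm_num)]
      refine ENNReal.ofReal_le_ofReal ?_
      have h1 : r / ϱ < 4 := by rw [div_lt_iff₀ hϱ0]; linarith
      have h2 : 1 / 4 < ϱ / r := by rw [lt_div_iff₀ hr0]; linarith
      have h3 : 0 < r / ϱ := by positivity
      nlinarith
    calc pressureD ((0 : ℝ), b • eZ) ϱ p
        = (ENNReal.ofReal ϱ ^ 2)⁻¹ *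
            ∫⁻ w in parCyl ((0 : ℝ), b • eZ) ϱ, ‖p w.1 w.2‖ₑ ^ (3 / 2 : ℝ) := rfl
      _ ≤ (ENNReal.ofReal ϱ ^ 2)⁻¹ *
            (ENNReal.ofReal r ^ 2 * pressureD ((0 : ℝ), b • eZ) r p) := by
          rw [← setLIntegral_eq_sq_mul_pressureD ((0 : ℝ), b • eZ) hr0]
          gcongr
          exact parCyl_mono _ hϱ0.le hϱ.2
      _ = ENNReal.ofReal ((r / ϱ) ^ 2) * pressureD ((0 : ℝ), b • eZ) r p := by
          rw [← mul_assoc, inv_sq_mul_sq hr0 hϱ0]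
      _ ≤ 64 * ENNReal.ofReal (ϱ / r) * pressureD ((0 : ℝ), b • eZ) r p := by gcongr
      _ ≤ cE * (ENNReal.ofReal (ϱ / r) * pressureD ((0 : ℝ), b • eZ) r p) := by
          rw [mul_assoc]; gcongr; exact le_max_right _ _
      _ ≤ cE * (ENNReal.ofReal (ϱ / r) * pressureD ((0 : ℝ), b • eZ) r p +
          ENNReal.ofReal ((r / ϱ) ^ 2) * cubicC ((0 : ℝ), b • eZ) r u) := by
          gcongr; exact le_self_add

/-! ### (as12) at the axis centres, from Remark 3.4 under (r2) -/

/-- **Seregin–Šverák 2009, (as12) under the hypotheses of Theorem 3.2** ("In addition to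
(as11), we consider the local energy inequality (as12)", arXiv p. 10; available by Remark 3.4:
under the standing assumptions, axial symmetry and (r2), `(v, q)` is a suitable weak solution in
`Q`). There is a universal `c` such that for every such pair, every weak spatial gradient `G` of
`u` on `Q`, all `|b| ≤ 1/4` and `0 < r ≤ 1/2` (so that `Q(z_b, r) ⊆ Q`):
`E(z_b, r/2; G) + A(z_b, r/2; u) ≤ c (C^{2/3}(z_b, r; u) + C(z_b, r; u) + D(z_b, r; p))`
(`SuitableOfBounded_holds` and `dissipationE_add_energyA_le_of_suitable`).
[cite: SereginSverak2009, proof of Lemma 3.5, (as12), with Remark 3.4; used in Lemma 3.6 (arXiv p. 10)] -/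
theorem localEnergy36 :
    ∃ c : ℝ≥0, ∀ (u : ℝ → EuclideanSpace ℝ (Fin 3) → EuclideanSpace ℝ (Fin 3))
      (p : ℝ → EuclideanSpace ℝ (Fin 3) → ℝ), IsAxisymmetricLocalSolution u p →
      IsBoundedAwayFromZero u →
      ∀ G : ℝ → EuclideanSpace ℝ (Fin 3) → EuclideanSpace ℝ (Fin 3) →L[ℝ] EuclideanSpace ℝ (Fin 3),
      HasWeakSpatialGradientOn (parCylOpens 0 1) u G →
      ∀ b : ℝ, |b| ≤ 1 / 4 → ∀ r : ℝ, 0 < r → r ≤ 1 / 2 →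
        dissipationE ((0 : ℝ), b • eZ) (r / 2) G + energyA ((0 : ℝ), b • eZ) (r / 2) u ≤
          c * (cubicC ((0 : ℝ), b • eZ) r u ^ (2 / 3 : ℝ) + cubicC ((0 : ℝ), b • eZ) r u +
            pressureD ((0 : ℝ), b • eZ) r p) := by
  obtain ⟨c, hc⟩ := dissipationE_add_energyA_le_of_suitable
  refine ⟨c, fun u p hsol hr2 G hG b hb r hr hr' => ?_⟩
  have hsw : IsSuitableWeakSolutionOn (parCylOpens 0 1) 1 0 u p :=
    SuitableOfBounded_holds u p hsol hr2
  have hsub : parCyl ((0 : ℝ), b • eZ) r ⊆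
      ((parCylOpens 0 1 : Opens (ℝ × EuclideanSpace ℝ (Fin 3))) :
        Set (ℝ × EuclideanSpace ℝ (Fin 3))) := by
    rw [coe_parCylOpens]
    exact parCyl_axis_subset hr.le (by linarith)
  exact hc _ u p G hsw hsol.locallyIntegrableOn_norm_pow_three hG ((0 : ℝ), b • eZ) r hr hsub

/-! ### (as11) at the axis centres under (r4), `ε`-form -/

/-- **Young's inequality in the form used for (as11)**: `L X^{9/10} ≤ ε X + L^{10} ε^{-9}` in
`ℝ≥0∞`, for `ε > 0` (write `L X^{9/10} = (εX)^{9/10} · (L ε^{-9/10})` and apply Young with the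
exponents `10/9` and `10`; the factors `9/10`, `1/10` are discarded).
[cite: SereginSverak2009, proof of Lemma 3.5, (as10)–(as11) ("Applying Young's inequality", arXiv p. 10)] -/
theorem mul_rpow_nine_tenths_le_eps (L X : ℝ≥0∞) {ε : ℝ≥0} (hε : 0 < ε) :
    L * X ^ (9 / 10 : ℝ) ≤ ε * X + L ^ (10 : ℝ) * ((ε : ℝ≥0∞)⁻¹) ^ (9 : ℝ) := by
  have hε0 : (ε : ℝ≥0∞) ≠ 0 := by exact_mod_cast hε.ne'
  have hεt : (ε : ℝ≥0∞) ≠ ⊤ := ENNReal.coe_ne_top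
  have hpq : (10 / 9 : ℝ).HolderConjugate 10 :=
    Real.holderConjugate_iff.2 ⟨by norm_num, by norm_num⟩
  have key := ENNReal.young_inequality (((ε : ℝ≥0∞) * X) ^ (9 / 10 : ℝ))
    (L * ((ε : ℝ≥0∞)⁻¹) ^ (9 / 10 : ℝ)) hpq
  have e1 : ((((ε : ℝ≥0∞) * X) ^ (9 / 10 : ℝ)) ^ (10 / 9 : ℝ)) = (ε : ℝ≥0∞) * X := by
    rw [← ENNReal.rpow_mul]; norm_num
  have e2 : (L * ((ε : ℝ≥0∞)⁻¹) ^ (9 / 10 : ℝ)) ^ (10 : ℝ) =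
      L ^ (10 : ℝ) * ((ε : ℝ≥0∞)⁻¹) ^ (9 : ℝ) := by
    rw [ENNReal.mul_rpow_of_nonneg _ _ (by norm_num), ← ENNReal.rpow_mul]; norm_num
  have e3 : ((ε : ℝ≥0∞) * X) ^ (9 / 10 : ℝ) * (L * ((ε : ℝ≥0∞)⁻¹) ^ (9 / 10 : ℝ)) =
      L * X ^ (9 / 10 : ℝ) := by
    have h1 : (ε : ℝ≥0∞) ^ (9 / 10 : ℝ) * ((ε : ℝ≥0∞)⁻¹) ^ (9 / 10 : ℝ) = 1 := by
      rw [← ENNReal.mul_rpow_of_nonneg _ _ (by norm_num), ENNReal.mul_inv_cancel hε0 hεt,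
        ENNReal.one_rpow]
    rw [ENNReal.mul_rpow_of_nonneg _ _ (by norm_num)]
    calc (ε : ℝ≥0∞) ^ (9 / 10 : ℝ) * X ^ (9 / 10 : ℝ) * (L * ((ε : ℝ≥0∞)⁻¹) ^ (9 / 10 : ℝ))
        = ((ε : ℝ≥0∞) ^ (9 / 10 : ℝ) * ((ε : ℝ≥0∞)⁻¹) ^ (9 / 10 : ℝ)) * (L * X ^ (9 / 10 : ℝ)) := by
          ring
      _ = L * X ^ (9 / 10 : ℝ) := by rw [h1, one_mul]
  rw [e3, e1, e2] at key
  have hd1 : (ε : ℝ≥0∞) * X / ENNReal.ofReal (10 / 9) ≤ (ε : ℝ≥0∞) * X := by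
    rw [div_eq_mul_inv]
    calc (ε : ℝ≥0∞) * X * (ENNReal.ofReal (10 / 9))⁻¹ ≤ (ε : ℝ≥0∞) * X * 1 := by
          gcongr
          exact ENNReal.inv_le_one.2 (ENNReal.one_le_ofReal.2 (by norm_num))
      _ = (ε : ℝ≥0∞) * X := mul_one _
  have hd2 : L ^ (10 : ℝ) * ((ε : ℝ≥0∞)⁻¹) ^ (9 : ℝ) / ENNReal.ofReal 10 ≤
      L ^ (10 : ℝ) * ((ε : ℝ≥0∞)⁻¹) ^ (9 : ℝ) := by
    rw [div_eq_mul_inv]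
    calc L ^ (10 : ℝ) * ((ε : ℝ≥0∞)⁻¹) ^ (9 : ℝ) * (ENNReal.ofReal 10)⁻¹
        ≤ L ^ (10 : ℝ) * ((ε : ℝ≥0∞)⁻¹) ^ (9 : ℝ) * 1 := by
          gcongr
          exact ENNReal.inv_le_one.2 (ENNReal.one_le_ofReal.2 (by norm_num))
      _ = L ^ (10 : ℝ) * ((ε : ℝ≥0∞)⁻¹) ^ (9 : ℝ) := mul_one _
  exact key.trans (add_le_add hd1 hd2)

/-- **Seregin–Šverák 2009, (as11) under the axis decay (r4), with the doubled radius of the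
tree's (as8).** For every constant `C` of (r4) and every `ε > 0` there is `F = f₁(ε, C)` such
that for every field `u` with a weak spatial gradient `G` on `Q` and `|x'| ‖u‖ ≤ C` a.e. on `Q`,
all `|b| ≤ 1/4` and `0 < r ≤ 3/8`:
`C(z_b, r; u) ≤ ε (E(z_b, 2r; G) + A(z_b, 2r; u)) + F`
("Applying Young's inequality in (as10), we arrive at the important estimate (as11) … `f₁(ε, C,
C₂)`"; here from `exists_cubicC_le_of_axisDecay`, the case `s = s₁, l = l₁` of Lemma 3.6, and
`mul_rpow_nine_tenths_le_eps`).
[cite: SereginSverak2009, proof of Lemma 3.5, (as8)–(as11), as used for Lemma 3.6 (arXiv pp. 9–10)] -/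
theorem cubicC_le_eps36 (C : ℝ) {ε : ℝ≥0} (hε : 0 < ε) :
    ∃ F : ℝ≥0, ∀ (u : ℝ → EuclideanSpace ℝ (Fin 3) → EuclideanSpace ℝ (Fin 3))
      (G : ℝ → EuclideanSpace ℝ (Fin 3) → EuclideanSpace ℝ (Fin 3) →L[ℝ] EuclideanSpace ℝ (Fin 3)),
      HasWeakSpatialGradientOn (parCylOpens 0 1) u G →
      (∀ᵐ z ∂(volume.restrict (parCyl 0 1)), cylRadius z.2 * ‖u z.1 z.2‖ ≤ C) →
      ∀ b : ℝ, |b| ≤ 1 / 4 → ∀ r : ℝ, 0 < r → r ≤ 3 / 8 →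
        cubicC ((0 : ℝ), b • eZ) r u ≤
          ε * (dissipationE ((0 : ℝ), b • eZ) (2 * r) G + energyA ((0 : ℝ), b • eZ) (2 * r) u) +
            F := by
  obtain ⟨K₁, hK₁⟩ := exists_cubicC_le_of_axisDecay
  set C' : ℝ≥0 := Real.toNNReal C with hC'
  set L : ℝ≥0∞ := (K₁ : ℝ≥0∞) * ((C' : ℝ≥0∞) + 1) ^ (6 / 5 : ℝ) with hL
  have hLt : L ≠ ⊤ :=
    ENNReal.mul_ne_top ENNReal.coe_ne_top (ENNReal.rpow_ne_top_of_nonneg (by norm_num) (by simp))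
  have hε0 : (ε : ℝ≥0∞) ≠ 0 := by exact_mod_cast hε.ne'
  set F : ℝ≥0∞ := L ^ (10 : ℝ) * ((ε : ℝ≥0∞)⁻¹) ^ (9 : ℝ) with hF
  have hFt : F ≠ ⊤ :=
    ENNReal.mul_ne_top (ENNReal.rpow_ne_top_of_nonneg (by norm_num) hLt)
      (ENNReal.rpow_ne_top_of_nonneg (by norm_num) (ENNReal.inv_ne_top.2 hε0))
  refine ⟨F.toNNReal, fun u G hG hr4 b hb r hr hr38 => ?_⟩
  rw [ENNReal.coe_toNNReal hFt]
  have hr4' : ∀ᵐ z ∂(volume.restrict (parCyl 0 1)), cylRadius z.2 * ‖u z.1 z.2‖ ≤ (C' : ℝ) :=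
    hr4.mono fun z hz => hz.trans (Real.le_coe_toNNReal C)
  have h1 := hK₁ u G C' b r hG hr4' hb hr hr38
  calc cubicC ((0 : ℝ), b • eZ) r u
      ≤ L * (energyA ((0 : ℝ), b • eZ) (2 * r) u +
          dissipationE ((0 : ℝ), b • eZ) (2 * r) G) ^ (9 / 10 : ℝ) := h1
    _ ≤ ε * (energyA ((0 : ℝ), b • eZ) (2 * r) u + dissipationE ((0 : ℝ), b • eZ) (2 * r) G) +
          F := mul_rpow_nine_tenths_le_eps L _ hε
    _ = ε * (dissipationE ((0 : ℝ), b • eZ) (2 * r) G + energyA ((0 : ℝ), b • eZ) (2 * r) u) +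
          F := by rw [add_comm (energyA _ _ _)]

/-! ### The contraction step with the doubled radius in (as11) -/

/-- **The contraction `ℰ(ϑ r) ≤ ½ ℰ(r) + f₃` of the printed iteration (arXiv p. 10) when (as11)
doubles the radius**, abstractly over `ℝ≥0∞`-valued `E, A, C, D`: from (as11) in the form
`C(r/2) ≤ ε (E(r) + A(r)) + F`, (as12), (as13), the scaling `C(κr) ≤ κ⁻² C(r)` and the
monotonicity `D(r/2) ≤ 4 D(r)`, for `8ϑ ≤ 1`, `(2K² + K)(8ϑ) ≤ ½`, `(6K + K²)(4ϑ)⁻² ε ≤ ½`: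
`ℰ(ϑ r) ≤ ½ ℰ(r) + (6K + K²)(4ϑ)⁻² F + K (4ϑ)⁻²`, `ℰ = E + A + D`, `0 < r < 1/4`. Proof: the
accepted `decay_step` from the radius `r/2` with ratio `2ϑ` bounds `ℰ(ϑ r)` by
`(2K² + K)(2ϑ) D(r/2) + (6K + K²)(4ϑ)⁻² C(r/2) + K(4ϑ)⁻²`; then `D(r/2) ≤ 4 D(r)` and (as11).
[cite: SereginSverak2009, proof of Lemma 3.5 (the displays after (as13), arXiv p. 10), as used for Lemma 3.6] -/
theorem decay_step_half36 {E A C D : ℝ → ℝ≥0∞} {K F ε ϑ : ℝ≥0} (hϑ : 0 < ϑ) (hϑ8 : 8 * ϑ ≤ 1)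
    (hKϑ : (2 * K ^ 2 + K) * (8 * ϑ) ≤ 2⁻¹) (hKε : (6 * K + K ^ 2) * (4 * ϑ)⁻¹ ^ 2 * ε ≤ 2⁻¹)
    (h11 : ∀ r ∈ Ioo (0 : ℝ) (1 / 4), C (r / 2) ≤ ε * (E r + A r) + F)
    (h12 : ∀ r ∈ Ioo (0 : ℝ) (1 / 4),
      E (r / 2) + A (r / 2) ≤ K * (C r ^ (2 / 3 : ℝ) + C r + D r))
    (h13 : ∀ r ∈ Ioo (0 : ℝ) (1 / 4), ∀ κ : ℝ≥0, 0 < κ → κ ≤ 1 →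
      D ((κ : ℝ) * r) ≤ K * (κ * D r + ((κ⁻¹ ^ 2 : ℝ≥0) : ℝ≥0∞) * C r))
    (hC : ∀ r ∈ Ioo (0 : ℝ) (1 / 4), ∀ κ : ℝ≥0, 0 < κ → κ ≤ 1 →
      C ((κ : ℝ) * r) ≤ ((κ⁻¹ ^ 2 : ℝ≥0) : ℝ≥0∞) * C r)
    (hD : ∀ r ∈ Ioo (0 : ℝ) (1 / 4), D (r / 2) ≤ 4 * D r)
    {r : ℝ} (hr : r ∈ Ioo (0 : ℝ) (1 / 4)) :
    E ((ϑ : ℝ) * r) + A ((ϑ : ℝ) * r) + D ((ϑ : ℝ) * r) ≤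
      2⁻¹ * (E r + A r + D r) +
        (((6 * K + K ^ 2) * (4 * ϑ)⁻¹ ^ 2 * F + K * (4 * ϑ)⁻¹ ^ 2 : ℝ≥0) : ℝ≥0∞) := by
  have h2ϑ : 0 < 2 * ϑ := by positivity
  have h2ϑ4 : 4 * (2 * ϑ) ≤ 1 := by
    calc 4 * (2 * ϑ) = 8 * ϑ := by ring
      _ ≤ 1 := hϑ8
  have hr2 : r / 2 ∈ Ioo (0 : ℝ) (1 / 4) := ⟨by linarith [hr.1], by linarith [hr.2]⟩
  have h1 := decay_step (E := E) (A := A) (C := C) (D := D) (K := K) h2ϑ h2ϑ4 h12 h13 hC hr2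
  have e : (((2 * ϑ : ℝ≥0) : ℝ) * (r / 2)) = (ϑ : ℝ) * r := by push_cast; ring
  have e2 : (2 * (2 * ϑ) : ℝ≥0) = 4 * ϑ := by ring
  rw [e, e2] at h1
  have hKϑ' : (((2 * K ^ 2 + K) * (8 * ϑ) : ℝ≥0) : ℝ≥0∞) ≤ 2⁻¹ := by
    have := ENNReal.coe_le_coe.2 hKϑ; simpa using this
  have hKε' : (((6 * K + K ^ 2) * (4 * ϑ)⁻¹ ^ 2 : ℝ≥0) : ℝ≥0∞) * ε ≤ 2⁻¹ := by
    have := ENNReal.coe_le_coe.2 hKε; push_cast at this ⊢; simpa using this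
  calc E ((ϑ : ℝ) * r) + A ((ϑ : ℝ) * r) + D ((ϑ : ℝ) * r)
      ≤ (((2 * K ^ 2 + K) * (2 * ϑ) : ℝ≥0) : ℝ≥0∞) * D (r / 2) +
        (((6 * K + K ^ 2) * (4 * ϑ)⁻¹ ^ 2 : ℝ≥0) : ℝ≥0∞) * C (r / 2) +
        ((K * (4 * ϑ)⁻¹ ^ 2 : ℝ≥0) : ℝ≥0∞) := h1
    _ ≤ (((2 * K ^ 2 + K) * (2 * ϑ) : ℝ≥0) : ℝ≥0∞) * (4 * D r) +
        (((6 * K + K ^ 2) * (4 * ϑ)⁻¹ ^ 2 : ℝ≥0) : ℝ≥0∞) * (ε * (E r + A r) + F) +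
        ((K * (4 * ϑ)⁻¹ ^ 2 : ℝ≥0) : ℝ≥0∞) := by
        gcongr
        · exact hD r hr
        · exact h11 r hr
    _ = (((2 * K ^ 2 + K) * (8 * ϑ) : ℝ≥0) : ℝ≥0∞) * D r +
        (((6 * K + K ^ 2) * (4 * ϑ)⁻¹ ^ 2 : ℝ≥0) : ℝ≥0∞) * ε * (E r + A r) +
        (((6 * K + K ^ 2) * (4 * ϑ)⁻¹ ^ 2 * F + K * (4 * ϑ)⁻¹ ^ 2 : ℝ≥0) : ℝ≥0∞) := by
        push_cast; ring
    _ ≤ 2⁻¹ * D r + 2⁻¹ * (E r + A r) +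
        (((6 * K + K ^ 2) * (4 * ϑ)⁻¹ ^ 2 * F + K * (4 * ϑ)⁻¹ ^ 2 : ℝ≥0) : ℝ≥0∞) := by
        gcongr
    _ = _ := by ring

/-! ### Lemma 3.6 -/

/-- **Seregin–Šverák 2009, Lemma 3.6, discharged**: `theorem ScaledEnergyBound36_holds :
ScaledEnergyBound36`. For all numbers `C, N₁, N₂` there is ONE `C₁` such that for every pair
`(u, p)` under the hypotheses of Thm. 3.2 — standing assumptions of §3 with axial symmetry, (r2),
(r4) `|x'| ‖u‖ ≤ C` a.e. on `Q` — with `∫_Q |u|³ ≤ N₁`, `∫_Q |p|^{3/2} ≤ N₂`, there is a weak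
spatial gradient `G = ∇u` on `Q` (Remark 3.4) with
`A(z_b,r;u) + E(z_b,r;G) + C(z_b,r;u) + D(z_b,r;p) ≤ C₁` for all `z_b = (b e₃, 0)`, `|b| ≤ 1/4`,
`0 < r < 1/4`. Proof "in the same way as Lemma 3.5": the inputs `pressureDecay36` ((as13)),
`localEnergy36` ((as12)), `cubicC_le_eps36` ((as11), case `s = s₁, l = l₁`) and the weak gradient
of `exists_hasWeakSpatialGradientOn_energy_lt_top`; the contraction `decay_step_half36` with `ϑ`
then `ε` chosen from the universal `K = max(c₁₂, c₁₃)`; the top scales `ϑ/4 ≤ r < 1/4` bounded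
through (as12) at radius `2r` and `Q(z_b, 2r) ⊆ Q` by `K, ϑ, N₁, N₂`; `iterate_halving`; and
finally `C(z_b, r)` by (as11) (`r < 1/8`) or by `Q(z_b, r) ⊆ Q` (`r ≥ 1/8`). Every constant
depends on `(C, N₁, N₂)` only (module docstring).
[cite: SereginSverak2009, Lemma 3.6 (asl5, arXiv p. 10), via the proof of Lemma 3.5 (arXiv pp. 9–10)] -/
theorem ScaledEnergyBound36_holds : ScaledEnergyBound36 := by
  intro C N₁ N₂
  obtain ⟨c₁₂, h12⟩ := localEnergy36
  obtain ⟨c₁₃, h13⟩ := pressureDecay36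
  -- constants depending on `c₁₂, c₁₃` only
  set K : ℝ≥0 := max c₁₂ c₁₃ with hK
  have hK12 : (c₁₂ : ℝ≥0∞) ≤ K := ENNReal.coe_le_coe.2 (le_max_left _ _)
  have hK13 : (c₁₃ : ℝ≥0∞) ≤ K := ENNReal.coe_le_coe.2 (le_max_right _ _)
  obtain ⟨ϑ, hϑ0, -, hLϑ⟩ := exists_ratio (8 * (2 * K ^ 2 + K) + 4)
  have hϑR : (0 : ℝ) < ϑ := by exact_mod_cast hϑ0
  have hKR : (0 : ℝ) ≤ K := K.coe_nonneg
  have hLϑR : (8 * (2 * (K : ℝ) ^ 2 + K) + 4) * ϑ ≤ 2⁻¹ := by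
    have h := NNReal.coe_le_coe.2 hLϑ
    push_cast at h
    exact h
  have hprod : 0 ≤ (2 * (K : ℝ) ^ 2 + K) * ϑ := by positivity
  have hϑ8R : 8 * (ϑ : ℝ) ≤ 1 := by nlinarith
  have hKϑR : (2 * (K : ℝ) ^ 2 + K) * (8 * ϑ) ≤ 2⁻¹ := by nlinarith
  have hϑ8 : 8 * ϑ ≤ 1 := by
    rw [← NNReal.coe_le_coe]; push_cast; exact hϑ8R
  have hKϑ : (2 * K ^ 2 + K) * (8 * ϑ) ≤ 2⁻¹ := by
    rw [← NNReal.coe_le_coe]; push_cast; exact hKϑR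
  have hϑ1R : (ϑ : ℝ) < 1 := by linarith
  obtain ⟨ε, hε0, hKε⟩ := exists_parameter ((6 * K + K ^ 2) * (4 * ϑ)⁻¹ ^ 2)
  -- the constant of (as11), depending on `ε` and `C` only
  obtain ⟨F, hF⟩ := cubicC_le_eps36 C hε0
  -- the top scales `r₀ ≤ r < 1/4`, `r₀ = ϑ/4`, and their bound `M = M(K, ϑ, N₁, N₂)`
  set r₀ : ℝ := (ϑ : ℝ) * (1 / 4) with hr₀
  have hr₀0 : 0 < r₀ := by positivity
  set T₁ : ℝ≥0∞ := ENNReal.ofReal ((1 / (2 * r₀)) ^ 2) * ENNReal.ofReal N₁ with hT₁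
  set T₂ : ℝ≥0∞ := ENNReal.ofReal ((1 / (2 * r₀)) ^ 2) * ENNReal.ofReal N₂ with hT₂
  set T₃ : ℝ≥0∞ := ENNReal.ofReal ((1 / r₀) ^ 2) * ENNReal.ofReal N₂ with hT₃
  set M : ℝ≥0∞ := K * (T₁ ^ (2 / 3 : ℝ) + T₁ + T₂) + T₃ with hM
  have hT₁t : T₁ ≠ ⊤ := ENNReal.mul_ne_top ENNReal.ofReal_ne_top ENNReal.ofReal_ne_top
  have hT₂t : T₂ ≠ ⊤ := ENNReal.mul_ne_top ENNReal.ofReal_ne_top ENNReal.ofReal_ne_top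
  have hT₃t : T₃ ≠ ⊤ := ENNReal.mul_ne_top ENNReal.ofReal_ne_top ENNReal.ofReal_ne_top
  have hMt : M ≠ ⊤ := by
    refine ENNReal.add_ne_top.2 ⟨ENNReal.mul_ne_top ENNReal.coe_ne_top ?_, hT₃t⟩
    exact ENNReal.add_ne_top.2 ⟨ENNReal.add_ne_top.2
      ⟨ENNReal.rpow_ne_top_of_nonneg (by norm_num) hT₁t, hT₁t⟩, hT₂t⟩
  set B : ℝ≥0 := (6 * K + K ^ 2) * (4 * ϑ)⁻¹ ^ 2 * F + K * (4 * ϑ)⁻¹ ^ 2 with hB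
  -- the crude bound for `C(z_b, r)`, `r ≥ 1/8`
  set T₄ : ℝ≥0∞ := ENNReal.ofReal ((1 / (1 / 8 : ℝ)) ^ 2) * ENNReal.ofReal N₁ with hT₄
  have hT₄t : T₄ ≠ ⊤ := ENNReal.mul_ne_top ENNReal.ofReal_ne_top ENNReal.ofReal_ne_top
  -- the final constant
  have hTot : M + 2 * B + (ε * (M + 2 * B) + F + T₄) ≠ ⊤ := by
    have hMB : M + 2 * B ≠ ⊤ := ENNReal.add_ne_top.2 ⟨hMt, by finiteness⟩
    exact ENNReal.add_ne_top.2 ⟨hMB, ENNReal.add_ne_top.2 ⟨ENNReal.add_ne_top.2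
      ⟨ENNReal.mul_ne_top (by finiteness) hMB, by finiteness⟩, hT₄t⟩⟩
  refine ⟨(M + 2 * B + (ε * (M + 2 * B) + F + T₄)).toNNReal, ?_⟩
  -- the solution
  intro u p hsol hr2 hr4 hN₁ hN₂
  obtain ⟨G, hG, -⟩ := exists_hasWeakSpatialGradientOn_energy_lt_top hsol.distributional
    hsol.velocity_L3 hsol.pressure_L32 hr2
  refine ⟨G, hG, ?_⟩
  rw [ENNReal.coe_toNNReal hTot]
  -- the global quantities
  have hC1 : cubicC 0 1 u ≤ ENNReal.ofReal N₁ := by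
    simpa [cubicC] using hN₁
  have hD1 : pressureD 0 1 p ≤ ENNReal.ofReal N₂ := by
    simpa [pressureD] using hN₂
  -- `ℰ_b ≤ M + 2B` on `(0, 1/4)`, uniformly in `|b| ≤ 1/4`
  have hΦ : ∀ b : ℝ, |b| ≤ 1 / 4 → ∀ r ∈ Ioo (0 : ℝ) (1 / 4),
      dissipationE ((0 : ℝ), b • eZ) r G + energyA ((0 : ℝ), b • eZ) r u +
        pressureD ((0 : ℝ), b • eZ) r p ≤ M + 2 * B := by
    intro b hb r hr
    refine iterate_halving (Φ := fun r => dissipationE ((0 : ℝ), b • eZ) r G +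
        energyA ((0 : ℝ), b • eZ) r u + pressureD ((0 : ℝ), b • eZ) r p)
      (R := 1 / 4) hϑR hϑ1R hr₀0 le_rfl ?_ ?_ hr.1 hr.2
    · -- the contraction `ℰ_b(ϑ r) ≤ ½ ℰ_b(r) + B`
      intro r hr0 hrR
      refine decay_step_half36 (E := fun r => dissipationE ((0 : ℝ), b • eZ) r G)
        (A := fun r => energyA ((0 : ℝ), b • eZ) r u)
        (C := fun r => cubicC ((0 : ℝ), b • eZ) r u)
        (D := fun r => pressureD ((0 : ℝ), b • eZ) r p) hϑ0 hϑ8 hKϑ hKε ?_ ?_ ?_ ?_ ?_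
        ⟨hr0, hrR⟩
      · -- (as11) at radius `r/2`
        intro r hr
        have h := hF u G hG hr4 b hb (r / 2) (by linarith [hr.1]) (by linarith [hr.2])
        have e : 2 * (r / 2) = r := by ring
        rw [e] at h
        exact h
      · -- (as12)
        intro r hr
        exact (h12 u p hsol hr2 G hG b hb r hr.1 (by linarith [hr.2])).trans (by gcongr)
      · -- (as13)
        intro r hr κ hκ hκ1
        exact (pressureD_mul_le_of_decay (h13 u p hsol b hb) hr hκ hκ1).trans (by gcongr)
      · -- scaling of `C`
        intro r hr κ hκ hκ1
        exact cubicC_mul_le _ u hr.1 hκ hκ1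
      · -- monotonicity of `D`
        intro r hr
        have hr0' : r ≠ 0 := hr.1.ne'
        have hsub : parCyl ((0 : ℝ), b • eZ) (r / 2) ⊆ parCyl ((0 : ℝ), b • eZ) r :=
          parCyl_mono _ (by linarith [hr.1]) (by linarith [hr.1])
        have e : (r / (r / 2)) ^ 2 = 4 := by
          rw [div_div_eq_mul_div, mul_div_right_comm, div_self hr0', one_mul]; norm_num
        calc pressureD ((0 : ℝ), b • eZ) (r / 2) p
            ≤ ENNReal.ofReal ((r / (r / 2)) ^ 2) * pressureD ((0 : ℝ), b • eZ) r p :=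
              pressureD_le_of_subset (by linarith [hr.1]) hr.1 hsub
          _ = 4 * pressureD ((0 : ℝ), b • eZ) r p := by rw [e, ENNReal.ofReal_ofNat]
    · -- the top scales, through (as12) at radius `2r` and `Q(z_b, 2r) ⊆ Q`
      intro r h1 h2
      have hr0 : 0 < r := hr₀0.trans_le h1
      have h2r : 0 < 2 * r := by positivity
      have hsub2 : parCyl ((0 : ℝ), b • eZ) (2 * r) ⊆ parCyl 0 1 :=
        parCyl_axis_subset h2r.le (by linarith)
      have hsub1 : parCyl ((0 : ℝ), b • eZ) r ⊆ parCyl 0 1 :=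
        parCyl_axis_subset hr0.le (by linarith [abs_nonneg b])
      have hratio2 : (1 / (2 * r)) ^ 2 ≤ (1 / (2 * r₀)) ^ 2 := by
        have : 1 / (2 * r) ≤ 1 / (2 * r₀) := one_div_le_one_div_of_le (by positivity) (by linarith)
        exact pow_le_pow_left₀ (by positivity) this 2
      have hratio1 : (1 / r) ^ 2 ≤ (1 / r₀) ^ 2 := by
        have : 1 / r ≤ 1 / r₀ := one_div_le_one_div_of_le hr₀0 h1
        exact pow_le_pow_left₀ (by positivity) this 2
      have hCT : cubicC ((0 : ℝ), b • eZ) (2 * r) u ≤ T₁ := by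
        calc cubicC ((0 : ℝ), b • eZ) (2 * r) u
            ≤ ENNReal.ofReal ((1 / (2 * r)) ^ 2) * cubicC 0 1 u :=
              cubicC_le_of_subset h2r one_pos hsub2
          _ ≤ ENNReal.ofReal ((1 / (2 * r₀)) ^ 2) * ENNReal.ofReal N₁ := by
              gcongr
      have hDT : pressureD ((0 : ℝ), b • eZ) (2 * r) p ≤ T₂ := by
        calc pressureD ((0 : ℝ), b • eZ) (2 * r) p
            ≤ ENNReal.ofReal ((1 / (2 * r)) ^ 2) * pressureD 0 1 p :=
              pressureD_le_of_subset h2r one_pos hsub2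
          _ ≤ ENNReal.ofReal ((1 / (2 * r₀)) ^ 2) * ENNReal.ofReal N₂ := by
              gcongr
      have hDT' : pressureD ((0 : ℝ), b • eZ) r p ≤ T₃ := by
        calc pressureD ((0 : ℝ), b • eZ) r p
            ≤ ENNReal.ofReal ((1 / r) ^ 2) * pressureD 0 1 p :=
              pressureD_le_of_subset hr0 one_pos hsub1
          _ ≤ ENNReal.ofReal ((1 / r₀) ^ 2) * ENNReal.ofReal N₂ := by
              gcongr
      have hEA : dissipationE ((0 : ℝ), b • eZ) r G + energyA ((0 : ℝ), b • eZ) r u ≤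
          K * (T₁ ^ (2 / 3 : ℝ) + T₁ + T₂) := by
        have h := h12 u p hsol hr2 G hG b hb (2 * r) h2r (by linarith)
        have e : 2 * r / 2 = r := by ring
        rw [e] at h
        calc dissipationE ((0 : ℝ), b • eZ) r G + energyA ((0 : ℝ), b • eZ) r u
            ≤ c₁₂ * (cubicC ((0 : ℝ), b • eZ) (2 * r) u ^ (2 / 3 : ℝ) +
                cubicC ((0 : ℝ), b • eZ) (2 * r) u + pressureD ((0 : ℝ), b • eZ) (2 * r) p) := h
          _ ≤ K * (T₁ ^ (2 / 3 : ℝ) + T₁ + T₂) := by gcongr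
      calc dissipationE ((0 : ℝ), b • eZ) r G + energyA ((0 : ℝ), b • eZ) r u +
            pressureD ((0 : ℝ), b • eZ) r p
          ≤ K * (T₁ ^ (2 / 3 : ℝ) + T₁ + T₂) + T₃ := add_le_add hEA hDT'
        _ = M := by rw [hM]
  -- the cubic term: (as11) for `r < 1/8`, the inclusion `Q(z_b, r) ⊆ Q` for `r ≥ 1/8`
  have hCub : ∀ b : ℝ, |b| ≤ 1 / 4 → ∀ r ∈ Ioo (0 : ℝ) (1 / 4),
      cubicC ((0 : ℝ), b • eZ) r u ≤ ε * (M + 2 * B) + F + T₄ := by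
    intro b hb r hr
    rcases lt_or_ge r (1 / 8) with h8 | h8
    · have h := hF u G hG hr4 b hb r hr.1 (by linarith)
      have h2r : 2 * r ∈ Ioo (0 : ℝ) (1 / 4) := ⟨by linarith [hr.1], by linarith⟩
      have hEA : dissipationE ((0 : ℝ), b • eZ) (2 * r) G + energyA ((0 : ℝ), b • eZ) (2 * r) u ≤
          M + 2 * B := le_self_add.trans (hΦ b hb (2 * r) h2r)
      calc cubicC ((0 : ℝ), b • eZ) r u
          ≤ ε * (dissipationE ((0 : ℝ), b • eZ) (2 * r) G + energyA ((0 : ℝ), b • eZ) (2 * r) u) +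
              F := h
        _ ≤ ε * (M + 2 * B) + F := by gcongr
        _ ≤ ε * (M + 2 * B) + F + T₄ := le_self_add
    · have hsub1 : parCyl ((0 : ℝ), b • eZ) r ⊆ parCyl 0 1 :=
        parCyl_axis_subset hr.1.le (by linarith [hr.2])
      have hratio : (1 / r) ^ 2 ≤ (1 / (1 / 8 : ℝ)) ^ 2 := by
        have : 1 / r ≤ 1 / (1 / 8 : ℝ) := one_div_le_one_div_of_le (by norm_num) h8
        exact pow_le_pow_left₀ (by positivity) this 2
      calc cubicC ((0 : ℝ), b • eZ) r u
          ≤ ENNReal.ofReal ((1 / r) ^ 2) * cubicC 0 1 u := cubicC_le_of_subset hr.1 one_pos hsub1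
        _ ≤ ENNReal.ofReal ((1 / (1 / 8 : ℝ)) ^ 2) * ENNReal.ofReal N₁ := by gcongr
        _ = T₄ := by rw [hT₄]
        _ ≤ ε * (M + 2 * B) + F + T₄ := le_add_self
  -- conclusion
  intro b hb r hr
  have h1 := hΦ b hb r hr
  have h2 := hCub b hb r hr
  calc energyA ((0 : ℝ), b • eZ) r u + dissipationE ((0 : ℝ), b • eZ) r G +
        cubicC ((0 : ℝ), b • eZ) r u + pressureD ((0 : ℝ), b • eZ) r p
      = (dissipationE ((0 : ℝ), b • eZ) r G + energyA ((0 : ℝ), b • eZ) r u +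
          pressureD ((0 : ℝ), b • eZ) r p) + cubicC ((0 : ℝ), b • eZ) r u := by ring
    _ ≤ (M + 2 * B) + (ε * (M + 2 * B) + F + T₄) := add_le_add h1 h2

end SereginSverak2009

end Literature.Analysis.FluidPDE
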